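import Summits.RiemannHypothesis.RiemannHypothesis.Theses.PluckedString
import Literature.NumberTheory.LFunctions.ZetaScrewThm17Proofs
import Literature.NumberTheory.LFunctions.ZetaScrewThm42Proofs

/-!
# Strategist census (Lean side) — typed decomposition attempts for `PluckedString.StringThesis`

Crux `stmt-RiemannHypothesis-2621` (`Summit.RiemannHypothesis.RiemannHypothesis.Theses.PluckedString.StringThesis`),
unit `cstrat-stmt-RiemannHypothesis-2621-r1` (crux-strategist, RESTATED re-audit), 2026-08-17.

`StringThesis` is RH by a landed theorem (`stringThesis_iff_riemannHypothesis` below = Suzuki2023 Thm 1.2,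
`Suzuki2023_thm12_holds`).  Each section types the pieces of ONE candidate seam of the statement
"Suzuki's kernel `Ψ(t)+Ψ(u)-Ψ(t-u)` is PSD on every finite configuration" and proves, where it is cheap,
the implication that decides criterion (a) load-bearing / (b) non-trivial proved assembly / (c) no piece
equivalent to the crux or to RH.  Companion: `STRATEGY-CENSUS.md` (§ Decomposition D1–D10) and the probe
files `bc/*_probe.lean`.
-/

noncomputable section

set_option linter.dupNamespace false

open scoped BigOperators Topology
open Literature.NumberTheory.LFunctions

namespace Summit.RiemannHypothesis.RiemannHypothesis.Cruxes.StringThesis.Strategist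

open Summit.RiemannHypothesis.RiemannHypothesis.Theses.PluckedString (StringThesis)

/-- The real quadratic form of Suzuki's kernel on a finite configuration `t` with weights `x`. -/
def screwForm {N : ℕ} (t x : Fin N → ℝ) : ℝ :=
  ∑ i, ∑ j, zetaScrewKernel (t i) (t j) * (x i * x j)

/-- `StringThesis` is by `rfl` the statement `∀ N t x, 0 ≤ screwForm t x`
(`zetaScrew_def`, `zetaScrewKernel_def` are `rfl`). -/
theorem stringThesis_iff : StringThesis ↔ ∀ (N : ℕ) (t x : Fin N → ℝ), 0 ≤ screwForm t x :=
  Iff.rfl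

/-- The landed equivalence that makes the crux RESTATED: `StringThesis ↔ RH` (Suzuki2023 Thm 1.2). -/
theorem stringThesis_iff_riemannHypothesis : StringThesis ↔ RiemannHypothesis :=
  stringThesis_iff.trans (Suzuki2023_thm12.iff_real Suzuki2023_thm12_holds).symm

/-! ## D1 — depth (window) seam: `X ⟺ ∀ a, X_a` -/

/-- Kernel PSD on configurations inside the closed window `[-a, a]` (the depth-`a` rung). -/
def WindowPSD (a : ℝ) : Prop :=
  ∀ (N : ℕ) (t x : Fin N → ℝ), (∀ i, |t i| ≤ a) → 0 ≤ screwForm t x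

/-- head piece: all rungs up to depth `A`. -/
def DepthHead (A : ℝ) : Prop := ∀ a : ℝ, a ≤ A → WindowPSD a

/-- tail piece: all rungs from depth `A` on (cofinal). -/
def DepthTail (A : ℝ) : Prop := ∀ a : ℝ, A ≤ a → WindowPSD a

/-- step piece of the depth induction. -/
def DepthStep : Prop := ∀ a : ℝ, 0 < a → WindowPSD a → WindowPSD (a + 1)

theorem WindowPSD.mono {a b : ℝ} (hab : a ≤ b) (h : WindowPSD b) : WindowPSD a :=
  fun N t x ht => h N t x fun i => (ht i).trans hab

theorem abs_le_sum_abs {N : ℕ} (t : Fin N → ℝ) (i : Fin N) : |t i| ≤ ∑ j, |t j| :=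
  Finset.single_le_sum (f := fun j => |t j|) (fun j _ => abs_nonneg (t j)) (Finset.mem_univ i)

/-- (c) fails for the cofinal piece: `DepthTail A → StringThesis` in three lines (monotonicity in `a`). -/
theorem stringThesis_of_depthTail (A : ℝ) (h : DepthTail A) : StringThesis := by
  rw [stringThesis_iff]
  intro N t x
  exact h (max A (∑ j, |t j|)) (le_max_left _ _) N t x
    fun i => (abs_le_sum_abs t i).trans (le_max_right _ _)

/-- … hence in `DepthHead A ∧ DepthTail A → StringThesis` the head is not load-bearing ((a) fails). -/
theorem stringThesis_of_depthHead_depthTail (A : ℝ) (_hH : DepthHead A) (hT : DepthTail A) :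
    StringThesis :=
  stringThesis_of_depthTail A hT

/-- The base of the depth induction is LANDED: Suzuki2023 Thm 4.2 (`Suzuki2023_thm42_screw_holds`)
gives a rung of positive depth. -/
theorem depthBase : ∃ b : ℝ, 0 < b ∧ WindowPSD b := by
  obtain ⟨a₀, ha₀, h⟩ := Suzuki2023_thm42_screw_holds
  refine ⟨a₀ / 4, by positivity, ?_⟩
  intro N t x ht
  have h' := (isPosSemidefKernelOn_zetaScrewKernel_iff _).1
    (h (a₀ / 2) (by positivity) (by linarith))
  refine h' N t x fun i => ?_
  have h1 := abs_le.1 (ht i)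
  rw [Set.mem_Ioo]
  constructor <;> linarith [h1.1, h1.2]

/-- (c) fails for the step piece: with the landed base, `DepthStep → StringThesis` (induction on depth). -/
theorem stringThesis_of_depthStep (h : DepthStep) : StringThesis := by
  obtain ⟨b, hb, hbase⟩ := depthBase
  have hn : ∀ n : ℕ, WindowPSD (b + n) := by
    intro n
    induction n with
    | zero => simpa using hbase
    | succ n ih =>
      have := h (b + n) (add_pos_of_pos_of_nonneg hb (Nat.cast_nonneg n)) ih
      simpa [Nat.cast_succ, add_assoc] using this
  rw [stringThesis_iff]
  intro N t x
  refine hn ⌈∑ j, |t j|⌉₊ N t x fun i => ?_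
  calc |t i| ≤ ∑ j, |t j| := abs_le_sum_abs t i
    _ ≤ ⌈∑ j, |t j|⌉₊ := Nat.le_ceil _
    _ ≤ b + ⌈∑ j, |t j|⌉₊ := le_add_of_nonneg_left hb.le

/-! ## D2 — parity seam: `X ⟸ X_even ∧ X_odd` -/

/-- even-sector piece: kernel `Ψ(t) + Ψ(u) − (Ψ(t−u) + Ψ(t+u))/2` PSD. -/
def EvenSector : Prop :=
  ∀ (N : ℕ) (t x : Fin N → ℝ), 0 ≤ ∑ i, ∑ j,
    (zetaScrew (t i) + zetaScrew (t j) - (zetaScrew (t i - t j) + zetaScrew (t i + t j)) / 2)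
      * (x i * x j)

/-- odd-sector piece: kernel `(Ψ(t+u) − Ψ(t−u))/2` PSD. -/
def OddSector : Prop :=
  ∀ (N : ℕ) (t x : Fin N → ℝ), 0 ≤ ∑ i, ∑ j,
    ((zetaScrew (t i + t j) - zetaScrew (t i - t j)) / 2) * (x i * x j)

/-- (b) fails: the seam is a one-liner — Suzuki's kernel is the SUM of the even and the odd kernel. -/
theorem stringThesis_of_even_odd (hE : EvenSector) (hO : OddSector) : StringThesis := by
  rw [stringThesis_iff]
  intro N t x
  have h := add_nonneg (hE N t x) (hO N t x)
  rw [← Finset.sum_add_distrib] at h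
  have key : screwForm t x = ∑ i, ((∑ j,
      (zetaScrew (t i) + zetaScrew (t j) - (zetaScrew (t i - t j) + zetaScrew (t i + t j)) / 2)
        * (x i * x j)) + ∑ j, ((zetaScrew (t i + t j) - zetaScrew (t i - t j)) / 2) * (x i * x j)) := by
    unfold screwForm
    refine Finset.sum_congr rfl fun i _ => ?_
    rw [← Finset.sum_add_distrib]
    refine Finset.sum_congr rfl fun j _ => ?_
    simp only [zetaScrewKernel]
    ring
  rw [key]
  exact h

/-- (c) fails for the odd piece: the one-point odd configuration gives `Ψ(2t) ≥ 0` for all `t`, hence RH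
by the landed Thm 1.7 (`riemannHypothesis_of_zetaScrew_nonneg`). -/
theorem riemannHypothesis_of_oddSector (hO : OddSector) : RiemannHypothesis := by
  refine riemannHypothesis_of_zetaScrew_nonneg fun s => ?_
  have h := hO 1 (fun _ => s / 2) (fun _ => 1)
  simp only [Finset.univ_unique, Fin.default_eq_zero, Finset.sum_singleton, mul_one, sub_self,
    zetaScrew_zero] at h
  have h2 : s / 2 + s / 2 = s := by ring
  rw [h2] at h
  linarith

/-- The even piece forces the doubling inequality `Ψ(2t) ≤ 4 Ψ(t)` (one-point even configuration);
iterating gives `Ψ(T) ≤ C·T²` on `[1, ∞)`, and Landau's lemma with polynomial slack then gives RH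
(census §D2; the Landau step is the proof pattern of `ZetaScrewThm17Proofs`, not re-landed here). -/
theorem zetaScrew_two_mul_le_of_evenSector (hE : EvenSector) (s : ℝ) :
    zetaScrew (2 * s) ≤ 4 * zetaScrew s := by
  have h := hE 1 (fun _ => s) (fun _ => 1)
  simp only [Finset.univ_unique, Fin.default_eq_zero, Finset.sum_singleton, mul_one, sub_self,
    zetaScrew_zero] at h
  have h2 : s + s = 2 * s := by ring
  rw [h2] at h
  linarith

/-! ## D3 — scale seam: lattice base ∧ dyadic refinement step -/

/-- kernel PSD on configurations drawn from the lattice `δℤ`. -/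
def LatticePSD (δ : ℝ) : Prop :=
  ∀ (N : ℕ) (k : Fin N → ℤ) (x : Fin N → ℝ), 0 ≤ screwForm (fun i => (k i : ℝ) * δ) x

/-- step piece: PSD on `δℤ` propagates to `(δ/2)ℤ`. -/
def LatticeRefine : Prop := ∀ δ : ℝ, 0 < δ → LatticePSD δ → LatticePSD (δ / 2)

/-- the honest name of the step piece: a conditional bridge into the crux. -/
def LatticeBridge : Prop := (∃ δ : ℝ, 0 < δ ∧ LatticePSD δ) → StringThesis

theorem LatticePSD.of_stringThesis (h : StringThesis) (δ : ℝ) : LatticePSD δ :=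
  fun N k x => (stringThesis_iff.1 h) N _ x

theorem continuous_screwForm {N : ℕ} (x : Fin N → ℝ) :
    Continuous fun t : Fin N → ℝ => screwForm t x := by
  have hΨ : Continuous zetaScrew := continuous_zetaScrew
  unfold screwForm zetaScrewKernel
  fun_prop

/-- Assembly of the scale seam — dyadic approximation + continuity of `Ψ` (about forty lines, so (b) is
formally met) … -/
theorem stringThesis_of_lattice {δ₀ : ℝ} (hδ₀ : 0 < δ₀) (h0 : LatticePSD δ₀) (hR : LatticeRefine) :
    StringThesis := by
  have hn : ∀ n : ℕ, LatticePSD (δ₀ / 2 ^ n) := by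
    intro n
    induction n with
    | zero => simpa using h0
    | succ n ih =>
      have := hR (δ₀ / 2 ^ n) (by positivity) ih
      simpa [pow_succ, div_div] using this
  rw [stringThesis_iff]
  intro N t x
  set δ : ℕ → ℝ := fun n => δ₀ / 2 ^ n with hδ
  have hδpos : ∀ n, 0 < δ n := fun n => by positivity
  set tn : ℕ → Fin N → ℝ := fun n i => (⌊t i / δ n⌋ : ℝ) * δ n with htn
  have happrox : ∀ n i, tn n i ≤ t i ∧ t i < tn n i + δ n := by
    intro n i
    have hδn := hδpos n
    constructor
    · have := mul_le_mul_of_nonneg_right (Int.floor_le (t i / δ n)) hδn.le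
      rwa [div_mul_cancel₀ _ hδn.ne'] at this
    · have := mul_lt_mul_of_pos_right (Int.lt_floor_add_one (t i / δ n)) hδn
      rw [div_mul_cancel₀ _ hδn.ne', add_mul, one_mul] at this
      exact this
  have hδ0 : Filter.Tendsto δ Filter.atTop (𝓝 0) :=
    tendsto_const_nhds.div_atTop (tendsto_pow_atTop_atTop_of_one_lt one_lt_two)
  have hconv : Filter.Tendsto tn Filter.atTop (𝓝 t) := by
    rw [tendsto_pi_nhds]
    intro i
    have hlo : Filter.Tendsto (fun n => t i - δ n) Filter.atTop (𝓝 (t i)) := by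
      simpa using tendsto_const_nhds.sub hδ0
    have hhi : Filter.Tendsto (fun n => t i + δ n) Filter.atTop (𝓝 (t i)) := by
      simpa using tendsto_const_nhds.add hδ0
    refine tendsto_of_tendsto_of_tendsto_of_le_of_le hlo hhi (fun n => ?_) (fun n => ?_)
    · have := (happrox n i).2
      simp only
      linarith
    · have := (happrox n i).1
      simp only
      linarith [(hδpos n).le]
  have hlim : Filter.Tendsto (fun n => screwForm (tn n) x) Filter.atTop (𝓝 (screwForm t x)) :=
    ((continuous_screwForm x).tendsto t).comp hconv
  exact ge_of_tendsto' hlim fun n => hn n N (fun i => ⌊t i / δ n⌋) x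

/-- … but (c)/(b) fail in substance: the step piece IS the conditional bridge
`(∃ δ, LatticePSD δ) → StringThesis` — modus ponens dressed as an induction. -/
theorem latticeRefine_iff_latticeBridge : LatticeRefine ↔ LatticeBridge := by
  constructor
  · rintro hR ⟨δ, hδ, h⟩
    exact stringThesis_of_lattice hδ h hR
  · intro hB δ hδ h
    exact LatticePSD.of_stringThesis (hB ⟨δ, hδ, h⟩) _

/-! ## D4 — Pontryagin-index seam: finitely many negative squares ∧ no finite defect -/

/-- "the kernel has at most `κ` negative squares": every `(κ+1)`-dimensional space of weights on every
configuration contains a non-zero vector on which the form is `≥ 0`. (For `κ = 0` this is `X`; RH-implied;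
by Kreĭn–Langer it says ζ has at most `κ` off-line zero pairs — cf. the tree's `BoundedWeilIndex ↔
CofiniteCriticalLine`, `RuelleBandCofiniteCriticalLineBoundedIndexIff.lean`.) -/
def NegIndexLE (κ : ℕ) : Prop :=
  ∀ (N : ℕ) (t : Fin N → ℝ) (V : Submodule ℝ (Fin N → ℝ)),
    Module.finrank ℝ V = κ + 1 → ∃ x ∈ V, x ≠ 0 ∧ 0 ≤ screwForm t x

def FiniteNegIndex : Prop := ∃ κ : ℕ, NegIndexLE κ

/-- "no finite defect": one negative square forces unboundedly many. -/
def NoFiniteDefect : Prop :=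
  (∃ (N : ℕ) (t x : Fin N → ℝ), screwForm t x < 0) → ∀ κ : ℕ, ¬ NegIndexLE κ

/-- (b) fails: the seam is five lines of propositional logic (a counting dichotomy, no analysis). -/
theorem stringThesis_of_pontryagin (hF : FiniteNegIndex) (hD : NoFiniteDefect) : StringThesis := by
  rw [stringThesis_iff]
  by_contra hX
  push_neg at hX
  obtain ⟨N, t, x, hlt⟩ := hX
  obtain ⟨κ, hκ⟩ := hF
  exact hD ⟨N, t, x, hlt⟩ κ hκ

/-! ## D5 — sparsification: cofinite critical line ∧ lattice one-point positivity (candidate D*) -/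

/-- = `RuelleBand.CofiniteCriticalLine` (item stmt-RiemannHypothesis-18110), verbatim. -/
def CofiniteCriticalLine : Prop :=
  {s : ℂ | riemannZeta s = 0 ∧ 0 < s.re ∧ s.re < 1 ∧ s.re ≠ 1 / 2}.Finite

/-- Suzuki positivity (Thm 1.7) sampled on an arithmetic progression through `0`. -/
def LatticeNonneg : Prop := ∃ δ : ℝ, 0 < δ ∧ ∀ k : ℕ, 0 ≤ zetaScrew (k * δ)

theorem cofiniteCriticalLine_of_riemannHypothesis (h : RiemannHypothesis) : CofiniteCriticalLine := by
  refine Set.Finite.subset Set.finite_empty ?_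
  rintro s ⟨hz, h0, h1, hne⟩
  exfalso
  refine hne (h s hz ?_ ?_)
  · rintro ⟨n, rfl⟩
    have hre : ((-2 : ℂ) * (n + 1)).re = -2 * (n + 1) := by simp
    rw [hre] at h0
    have hn : (0 : ℝ) ≤ n := n.cast_nonneg
    linarith
  · rintro rfl
    simp at h1

theorem latticeNonneg_of_riemannHypothesis (h : RiemannHypothesis) : LatticeNonneg :=
  ⟨1, one_pos, fun k => ZetaScrewThm17.zetaScrew_nonneg_of_RH h _⟩

/-- The assembly shape of D* (a genuine oscillation lemma; NOT proved this cycle — census §D5). -/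
def DStarAssembly : Prop := CofiniteCriticalLine → LatticeNonneg → StringThesis

/-! ## D6 — moment / Hankel seam (Suzuki2023 Thm 1.8) — typed only -/

/-- `μ_n = ∫₀^∞ 4⁻¹ e^{-t/2} Ψ(t) tⁿ dt` (Suzuki2023 (1.13)). -/
def screwMoment (n : ℕ) : ℝ :=
  ∫ t in Set.Ioi (0 : ℝ), 4⁻¹ * Real.exp (-t / 2) * zetaScrew t * t ^ n

def HankelDetNonneg : Prop :=
  ∀ n : ℕ, 0 ≤ (Matrix.of fun i j : Fin (n + 1) => screwMoment ((i : ℕ) + j)).det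

def ShiftedHankelDetNonneg : Prop :=
  ∀ n : ℕ, 0 ≤ (Matrix.of fun i j : Fin (n + 1) => screwMoment ((i : ℕ) + j + 1)).det

/-! ## D7 — height-of-zeros seam: zeros below `T` ∧ zeros above `T` -/

def OnLineBelow (T : ℝ) : Prop :=
  ∀ s : ℂ, riemannZeta s = 0 → (¬∃ n : ℕ, s = -2 * (n + 1)) → s ≠ 1 → |s.im| ≤ T → s.re = 1 / 2

def OnLineAbove (T : ℝ) : Prop :=
  ∀ s : ℂ, riemannZeta s = 0 → (¬∃ n : ℕ, s = -2 * (n + 1)) → s ≠ 1 → T < |s.im| → s.re = 1 / 2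

/-- (b) fails: a case split and the landed Thm 1.2. -/
theorem stringThesis_of_height (T : ℝ) (hB : OnLineBelow T) (hA : OnLineAbove T) : StringThesis :=
  stringThesis_iff_riemannHypothesis.2 fun s hz ht h1 =>
    (le_or_gt |s.im| T).elim (hB s hz ht h1) (hA s hz ht h1)

/-! ## D8 — σ-partition of the strip: quasi-RH beyond `σ₀` ∧ strip-RH up to `σ₀` -/

/-- = `Literature.NumberTheory.LFunctions.QuasiRiemannHypothesis σ₀` (no zeros with `σ₀ < re s < 1`);
open and strictly weaker than RH for `1/2 < σ₀ < 1` (a zero-free vertical strip). -/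
def QuasiRH (σ₀ : ℝ) : Prop := QuasiRiemannHypothesis σ₀

/-- no zeros in the sub-strip `1/2 < re s ≤ σ₀` ("RH near the line"); open, RH-implied. -/
def StripRH (σ₀ : ℝ) : Prop :=
  ∀ s : ℂ, riemannZeta s = 0 → 1 / 2 < s.re → s.re ≤ σ₀ → False

/-- (b) fails: the seam is a case split on `re s` through the landed `QuasiRH (1/2) ↔ RH`. -/
theorem stringThesis_of_sigma_partition (σ₀ : ℝ) (hQ : QuasiRH σ₀) (hS : StripRH σ₀) :
    StringThesis :=
  stringThesis_iff_riemannHypothesis.2 <| quasiRiemannHypothesis_one_half_iff_holds.1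
    fun s hz h1 h2 => (le_or_gt s.re σ₀).elim (hS s hz h1) fun h => hQ s hz h h2

/-! ## D11 — zeros-language bridge: cofinite critical line ∧ zero-or-infinity (card `zero-or-infinity-offline`) -/

/-- off-line zeros are absent or infinitely many (the open card's ZOI in disjunctive shape). -/
def OffLineEmptyOrInfinite : Prop :=
  {s : ℂ | riemannZeta s = 0 ∧ 0 < s.re ∧ s.re < 1 ∧ s.re ≠ 1 / 2} = ∅ ∨
    {s : ℂ | riemannZeta s = 0 ∧ 0 < s.re ∧ s.re < 1 ∧ s.re ≠ 1 / 2}.Infinite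

/-- (b) fails: the seam is `finite ∧ (empty ∨ infinite) ⟹ empty` plus the landed strip form of RH. -/
theorem stringThesis_of_cofinite_zoi (hF : CofiniteCriticalLine) (hZ : OffLineEmptyOrInfinite) :
    StringThesis := by
  refine stringThesis_iff_riemannHypothesis.2 (riemannHypothesis_iff_strip_holds.2 fun s hz h0 h1 => ?_)
  rcases hZ with h | h
  · by_contra hne
    have : s ∈ ({s : ℂ | riemannZeta s = 0 ∧ 0 < s.re ∧ s.re < 1 ∧ s.re ≠ 1 / 2} : Set ℂ) :=
      ⟨hz, h0, h1, hne⟩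
    rw [h] at this
    exact this
  · exact absurd hF h

/-! ## D13 — Schoenberg seam: `X ⟺ ∀ s > 0, e^{-sΨ}` positive definite; every single piece is RH -/

/-- Schoenberg piece at parameter `s`: the translation-invariant kernel `e^{-sΨ(t-u)}` is PSD. -/
def SchoenbergPD (s : ℝ) : Prop :=
  ∀ (N : ℕ) (t x : Fin N → ℝ), 0 ≤ ∑ i, ∑ j, Real.exp (-(s * zetaScrew (t i - t j))) * (x i * x j)

/-- (c) fails for EVERY piece: a PSD translation-invariant kernel is bounded by its diagonal
(two-point configuration `(u, 0)`, weights `(1, -1)`), so `Ψ ≥ 0`, so RH by the landed Thm 1.7. -/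
theorem riemannHypothesis_of_schoenbergPD {s : ℝ} (hs : 0 < s) (h : SchoenbergPD s) :
    RiemannHypothesis := by
  refine riemannHypothesis_of_zetaScrew_nonneg fun u => ?_
  have h2 := h 2 ![u, 0] ![1, -1]
  simp only [Fin.sum_univ_two, Matrix.cons_val_zero, Matrix.cons_val_one, sub_self,
    zetaScrew_zero, mul_zero, neg_zero, Real.exp_zero, mul_one, one_mul, mul_neg, neg_mul,
    neg_neg, sub_zero, zero_sub, zetaScrew_neg] at h2
  -- h2 : 0 ≤ 1 + -rexp (-(s * zetaScrew u)) + (-rexp (-(s * zetaScrew u)) + 1)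
  have hle : Real.exp (-(s * zetaScrew u)) ≤ 1 := by linarith
  have : -(s * zetaScrew u) ≤ 0 := by
    rwa [← Real.exp_le_exp, Real.exp_zero]
  nlinarith

/-! ## D16 — Hamburger positivity of the moments ∧ a zero-free strip (the substance-honest split; seam NOT landed)

`HankelPSD ∧ GrowthLT κ → StringThesis` for any `κ < 1/2`: growth `|Ψ(t)| ≤ C e^{κ|t|}` makes the weight
`w = 4⁻¹e^{-t/2}|Ψ|` exponentially decaying, hence its moment problem determinate (Carleman) and polynomials dense in
`L²(w dt)` (M. Riesz / Laplace analyticity); then `∫ p² dλ ≥ 0` for all polynomials (= `HankelPSD`, `λ = 4⁻¹e^{-t/2}Ψ dt`)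
upgrades to `∫ g dλ ≥ 0` for all `g ≥ 0`, i.e. `Ψ ≥ 0` on `(0,∞)`, and `stringThesis_of_nonneg_on_pos` below finishes.
Only the typed pieces, the statement of the seam and its landed endgame are recorded here (census §6 D16). -/

/-- Hamburger positivity of Suzuki's moment sequence `μ_n = screwMoment n` (PSD Hankel FORMS — the shape a seam uses;
Suzuki2023 Thm 1.8 states the determinant version).  RH-implied; not known to imply RH without a zero-free strip.
Typing note (checklist (ii)): `screwMoment` is a Bochner integral; integrability of `t ↦ e^{-t/2}Ψ(t)tⁿ` on `(0,∞)` holds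
(Suzuki2023 Thm 1.1 (3), via de la Vallée Poussin) but is not landed; under `GrowthLT κ`, `κ < 1/2`, it is immediate. -/
def HankelPSD : Prop :=
  ∀ (n : ℕ) (a : Fin (n + 1) → ℝ), 0 ≤ ∑ i, ∑ j, a i * a j * screwMoment ((i : ℕ) + j)

/-- two-sided exponential growth bound of rate `κ`; for `κ < 1/2` this is a zero-free strip in disguise
(lower bound ⇒ `QuasiRH (1/2 + κ + ε)` by Landau; conversely quasi-RH gives it by the truncated explicit formula). -/
def GrowthLT (κ : ℝ) : Prop := ∃ C : ℝ, ∀ t : ℝ, |zetaScrew t| ≤ C * Real.exp (κ * |t|)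

/-- The D16 seam as a statement (≈ 10³ Lean lines of weighted-L² analysis; recommended, not proved this cycle). -/
def D16Assembly (κ : ℝ) : Prop := HankelPSD → GrowthLT κ → StringThesis

/-- Landed endgame of the D16 seam: positivity of `Ψ` on `(0, ∞)` already gives `X` (evenness, `Ψ(0) = 0`, Thm 1.7, Thm 1.2). -/
theorem stringThesis_of_nonneg_on_pos (h : ∀ t : ℝ, 0 < t → 0 ≤ zetaScrew t) : StringThesis := by
  refine stringThesis_iff_riemannHypothesis.2 (riemannHypothesis_of_zetaScrew_nonneg fun t => ?_)
  rcases lt_trichotomy t 0 with ht | rfl | ht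
  · simpa using h (-t) (by linarith)
  · simp [zetaScrew_zero]
  · exact h t ht

/-- shape check only: the seam statement composes with the pieces to the crux BY NAME. -/
example : D16Assembly (1 / 4) → HankelPSD → GrowthLT (1 / 4) → StringThesis := fun h => h

end Summit.RiemannHypothesis.RiemannHypothesis.Cruxes.StringThesis.Strategist

end
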